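import Summits.QuantumFields.YangMills.Theses.ModerateWindow
import Summits.QuantumFields.YangMills.Theorems.SmallFieldWideningLargeFieldMassRefinementTailSubGaussianRung

/-!
# Route `ModerateWindow` — the glue item `HistoryTailOfWindow` (stmt-QuantumFields-27840) PROVED: a WINDOWED sub-Gaussian moment bound at the
# running scale (`WindowMGFL`, stmt-QuantumFields-27839) gives the body of crux `UnitScaleTilt.HistoryTailL` (stmt-QuantumFields-19936)

Cell `ym3-torus` (YM ladder rung R3 = continuum SU(2) Yang–Mills on the three-torus; NOT the Clay problem), LEAD seat `ym-ust-19936-w1` gen 5 on the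
crux `HistoryTailL`.  The ideator line «moderate-window» (`Cruxes/HistoryTailL/Lines/moderate_window.lean`, route `ModerateWindow`, DRAFT) composes
`HistoryTailL_of := stub_historyTailOfWindow (WindowMGFL_of stub_fineWindow stub_deepWindow)`; THIS FILE discharges the glue stub
`stub_historyTailOfWindow` BY NAME (`historyTailOfWindow : Theses.ModerateWindow.HistoryTailOfWindow`), so that line rests on its two ANALYTIC regime
stubs only, and records the cross-route door `historyTailL_of_windowMGFL : WindowMGFL → UnitScaleTilt.HistoryTailL`.

THE ARGUMENT (elementary; [Balaban1985UV3] (7) p.257 for `p(g) = b₀(1 + log g⁻¹)^{p₀}`, (71) p.273 for the Gaussian rate; Chernoff on a window):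
fix `L`; `WindowMGFL` gives ONE window exponent `ε > 0` and a threshold `0 < γ₁ ≤ 1`; given thresholds `(b₁, p₁)` put `b₀ := max b₁ 1`,
`p₀ := max p₁ 3` (BEFORE `m`); for a family `F` (`F.L = L`) and `0 < γ ≤ γ₁` take the window data `(H, D, A)`.  At height `j` of cut-off `K` write
`g = g_{K−j} = √(γL^{−(K−j)})`, `β = β_{K−j} = g⁻²  ≥ 1`, `p = p(g) = b₀(1 + ½ log β)^{p₀}`.
* §1 `one_add_half_log_rpow_le`: `log β ≤ β^a/a` (Mathlib `Real.log_le_rpow_div`) and `1 ≤ β^a` give `(1 + ½ log β)^{q} ≤ (1 + 1/(2a))^{q}·β^{aq}`;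
  with `a = ε/p₀`: `p(g) ≤ M·β^ε`, `M = b₀(1 + p₀/(2ε))^{p₀}` (`pFun_sqrt_le_mul_inv_rpow`).
* §2 `perPlaquette_of_windowMGF`: with `N := max(2H, M)` the Chernoff parameter `t := p/N` lies in the window `0 ≤ t ≤ β^ε`, and Markov at `t`
  (`ProbabilityTheory.measure_ge_le_exp_mul_mgf`; integrability is free for the bounded observable, ✓`integrable_exp_mul_dist1_iter`) gives
  `Gibbs_K{θ(K−j) ≤ |Ū^{j}(∂p) − 1|} ≤ e^{−tp}·D β^A e^{Ht²} ≤ D·β^A·e^{−p²/(2N)}` (`Ht² − tp ≤ −p²/(2N)` as `H ≤ N/2`) — EXACTLY the per-plaquette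
  schema consumed by the tree's bookkeeping ✓`T3AveragedTailProfile.historyTailAt_of_perPlaquette` (`C := D`, `A`, `c := 1/(2N)`).
* §3 `historyTailAt_of_windowMGF` (one family, one coupling, every `m ≥ 1`), `historyTailOfWindow` (the item BY NAME), `historyTailL_of_windowMGFL`.

WHAT THIS IS NOT.  `WindowMGFL` is the HYPOTHESIS and stays open (XL; the unprinted probabilistic content of Bałaban's (α) representation at the
averaged heights); nothing here proves the crux `HistoryTailL`, the rung R3 (`YM3TorusSU2`), d = 4, a continuum limit or a mass gap.  YM₃ on T³ is
rung R3 of the programme, NOT the Clay problem.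

References: T. Bałaban, CMP **102** (1985) 255–275 [Balaban1985UV3] ((7) p.257, (41) p.266, (71) p.273); H. Döring, S. Jansen, K. Schubert,
Probab. Surveys 19 (2022) (doi:10.1214/22-ps7; the moderate-deviation window of the method of cumulants).
-/

noncomputable section

open MeasureTheory ProbabilityTheory Real
open Literature.MathematicalPhysics.QuantumFieldTheory.Balaban1983to89
open Literature.MathematicalPhysics.QuantumFieldTheory.Balaban1983to89.T3ContinuumYM3Torus
open Literature.MathematicalPhysics.QuantumFieldTheory.Balaban1983to89.T3UnitScaleTilt
open Literature.MathematicalPhysics.QuantumFieldTheory.Balaban1983to89.T3UnitLawDensityEML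
open Literature.MathematicalPhysics.QuantumFieldTheory.Balaban1983to89.T3AveragedTailProfile
open Literature.MathematicalPhysics.QuantumFieldTheory.Balaban1983to89.T3Thresholds
open Summit.QuantumFields.YangMills.Theorems.LargeFieldMassRefinementTailSubGaussianRung (integrable_exp_mul_dist1_iter)

namespace Summit.QuantumFields.YangMills.Theorems.ModerateWindowHistoryTailOfWindow

/-! ## §1 `log` against a power: `p(g) ≤ M·β^ε` -/

/-- For `β ≥ 1`, `a > 0`, `q ≥ 0`: `(1 + ½ log β)^q ≤ (1 + 1/(2a))^q · β^{aq}` — from `log β ≤ β^a/a` (`Real.log_le_rpow_div`) and `1 ≤ β^a`.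
[folklore] -/
theorem one_add_half_log_rpow_le {β a q : ℝ} (hβ : 1 ≤ β) (ha : 0 < a) (hq : 0 ≤ q) :
    (1 + 1 / 2 * Real.log β) ^ q ≤ (1 + 1 / (2 * a)) ^ q * β ^ (a * q) := by
  have hβ0 : 0 ≤ β := zero_le_one.trans hβ
  have hlog0 : 0 ≤ Real.log β := Real.log_nonneg hβ
  have hlog : Real.log β ≤ β ^ a / a := Real.log_le_rpow_div hβ0 ha
  have hβa : 1 ≤ β ^ a := Real.one_le_rpow hβ ha.le
  have hβa0 : 0 ≤ β ^ a := zero_le_one.trans hβa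
  have h1 : 1 + 1 / 2 * Real.log β ≤ (1 + 1 / (2 * a)) * β ^ a := by
    have h2 : 1 / 2 * Real.log β ≤ 1 / 2 * (β ^ a / a) := mul_le_mul_of_nonneg_left hlog (by norm_num)
    have h3 : (1 + 1 / (2 * a)) * β ^ a = β ^ a + 1 / 2 * (β ^ a / a) := by
      field_simp
    rw [h3]
    linarith
  have h0 : 0 ≤ 1 + 1 / 2 * Real.log β := by positivity
  calc (1 + 1 / 2 * Real.log β) ^ q ≤ ((1 + 1 / (2 * a)) * β ^ a) ^ q := Real.rpow_le_rpow h0 h1 hq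
    _ = (1 + 1 / (2 * a)) ^ q * (β ^ a) ^ q := Real.mul_rpow (by positivity) hβa0
    _ = (1 + 1 / (2 * a)) ^ q * β ^ (a * q) := by rw [← Real.rpow_mul hβ0]

/-- **`p(g) ≤ M·β^ε`**: for a coupling `g = √x` with `0 < x ≤ 1` (so `β = x⁻¹ ≥ 1`, `log g⁻¹ = ½ log β`), `b₀ ≥ 0`, `p₀ > 0`, `ε > 0`:
`p(g) = b₀(1 + log g⁻¹)^{p₀} ≤ b₀(1 + p₀/(2ε))^{p₀} · β^ε` (§1 with `a = ε/p₀`). [cite: Balaban1985UV3, (7) p.257] -/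
theorem pFun_sqrt_le_mul_inv_rpow {x b₀ p₀ ε : ℝ} (hx0 : 0 < x) (hx1 : x ≤ 1) (hb₀ : 0 ≤ b₀) (hp₀ : 0 < p₀) (hε : 0 < ε) :
    B10.pFun b₀ p₀ (Real.sqrt x) ≤ b₀ * (1 + p₀ / (2 * ε)) ^ p₀ * x⁻¹ ^ ε := by
  have hβ : 1 ≤ x⁻¹ := (one_le_inv₀ hx0).mpr hx1
  have hlog : Real.log (Real.sqrt x)⁻¹ = 1 / 2 * Real.log x⁻¹ := by
    rw [Real.log_inv, Real.log_sqrt hx0.le, Real.log_inv]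
    ring
  unfold B10.pFun
  rw [hlog]
  have ha : 0 < ε / p₀ := div_pos hε hp₀
  have h := one_add_half_log_rpow_le hβ ha hp₀.le
  have h2 : ε / p₀ * p₀ = ε := div_mul_cancel₀ ε hp₀.ne'
  have h3 : 1 / (2 * (ε / p₀)) = p₀ / (2 * ε) := by
    field_simp
  rw [h2, h3] at h
  calc b₀ * (1 + 1 / 2 * Real.log x⁻¹) ^ p₀ ≤ b₀ * ((1 + p₀ / (2 * ε)) ^ p₀ * x⁻¹ ^ ε) := mul_le_mul_of_nonneg_left h hb₀
    _ = b₀ * (1 + p₀ / (2 * ε)) ^ p₀ * x⁻¹ ^ ε := by ring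

/-! ## §2 Chernoff on the window: the per-plaquette schema from `WindowMGFL`'s body -/

/-- **THE PER-PLAQUETTE SCHEMA FROM A WINDOWED MOMENT BOUND** (`0 < γ ≤ 1`, `b₀ ≥ 0`, `p₀ > 0`; one family, one coupling): if for some `ε > 0`,
`H > 0`, `D ≥ 0`, `A` the normalised deviations `Y = |Ū^{j}(∂p) − 1|/g_{K−j}` satisfy `∫ e^{tY} dGibbs_K ≤ D·β_{K−j}^A·e^{Ht²}` on the window
`0 ≤ t ≤ β_{K−j}^ε` (all cut-offs `K`, heights `1 ≤ j ≤ K`, plaquettes `p`), then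
`Gibbs_K{θ(K−j) ≤ |Ū^{j}(∂p) − 1|} ≤ D·β_{K−j}^A·exp(−p(g_{K−j})²/(2N))` with `N = max(2H, b₀(1 + p₀/(2ε))^{p₀})` — Markov at the
admissible parameter `t = p(g)/N ≤ β^ε` (§1), `Ht² − tp ≤ −p²/(2N)`.  The shape consumed by `T3AveragedTailProfile.historyTailAt_of_perPlaquette`.
[cite: Balaban1985UV3, (7) p.257 and (71) p.273] -/
theorem perPlaquette_of_windowMGF (F : T3Family) {γ b₀ p₀ : ℝ} (hγ : 0 < γ) (hγ1 : γ ≤ 1) (hb₀ : 0 ≤ b₀) (hp₀ : 0 < p₀)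
    {ε H D : ℝ} {A : ℕ} (hε : 0 < ε) (hH : 0 < H) (hD : 0 ≤ D)
    (hmgf : ∀ (K j : ℕ), 1 ≤ j → j ≤ K → ∀ (p : Plaq (F.P K) j) (t : ℝ), 0 ≤ t →
      t ≤ (F.scheme ℰp γ).β (K - j) ^ ε →
      ∫ U, Real.exp (t * (GaugeGroup.dist1 (GaugeField.plaqHol
          (Averaging.iter (fun i => BlockAveraging.blockAvg (P := F.P K) (j := i) ℰp) j U) p) /
            Real.sqrt (γ * ((F.L : ℝ)⁻¹) ^ (K - j)))) ∂(gibbsK F ℰp γ K) ≤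
        D * (F.scheme ℰp γ).β (K - j) ^ A * Real.exp (H * t ^ 2)) :
    ∀ (K j : ℕ), 1 ≤ j → j ≤ K → ∀ p : Plaq (F.P K) j,
      (gibbsK F ℰp γ K).real
          {U | θBal F.L γ b₀ p₀ (K - j) ≤
            GaugeGroup.dist1 (GaugeField.plaqHol
              (Averaging.iter (fun i => BlockAveraging.blockAvg (P := F.P K) (j := i) ℰp) j U) p)} ≤
        D * (F.scheme ℰp γ).β (K - j) ^ A *
          Real.exp (-(1 / (2 * max (2 * H) (b₀ * (1 + p₀ / (2 * ε)) ^ p₀)) *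
            B10.pFun b₀ p₀ (Real.sqrt (γ * ((F.L : ℝ)⁻¹) ^ (K - j))) ^ 2)) := by
  intro K j hj1 hjK p
  haveI := isProbabilityMeasure_gibbsK F ℰp hγ.le K
  have hL : 1 ≤ F.L := F.hL.2.le
  have hL' : (1 : ℝ) ≤ F.L := by exact_mod_cast hL
  -- the coupling `g = √x`, `x = γ L^{-(K-j)}`, and `β = x⁻¹`
  set x : ℝ := γ * ((F.L : ℝ)⁻¹) ^ (K - j) with hx
  have hinv0 : 0 ≤ (F.L : ℝ)⁻¹ := inv_nonneg.mpr (by linarith)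
  have hinv1 : (F.L : ℝ)⁻¹ ≤ 1 := inv_le_one_of_one_le₀ hL'
  have hx0 : 0 < x := mul_pos hγ (pow_pos (inv_pos.mpr (by linarith)) _)
  have hx1 : x ≤ 1 := mul_le_one₀ hγ1 (pow_nonneg hinv0 _) (pow_le_one₀ hinv0 hinv1)
  set g : ℝ := Real.sqrt x with hg
  have hg0 : 0 < g := Real.sqrt_pos.mpr hx0
  have hg1 : g ≤ 1 := Real.sqrt_le_one.mpr hx1
  set pg : ℝ := B10.pFun b₀ p₀ g with hpg
  have hpg0 : 0 ≤ pg := B10.pFun_nonneg b₀ p₀ g hb₀ hg0 hg1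
  have hβ : (F.scheme ℰp γ).β (K - j) = x⁻¹ := rfl
  -- the constants `M ≤ N`, `2H ≤ N`
  set Mc : ℝ := b₀ * (1 + p₀ / (2 * ε)) ^ p₀ with hMc
  set N : ℝ := max (2 * H) Mc with hN
  have hN0 : 0 < N := lt_max_of_lt_left (by linarith)
  have hHN : H ≤ N / 2 := by
    have := le_max_left (2 * H) Mc
    linarith
  have hMcN : Mc ≤ N := le_max_right _ _
  -- `p(g) ≤ M β^ε`
  have hpgle : pg ≤ Mc * x⁻¹ ^ ε := pFun_sqrt_le_mul_inv_rpow hx0 hx1 hb₀ hp₀ hε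
  -- the Chernoff parameter lies in the window
  set t : ℝ := pg / N with ht
  have ht0 : 0 ≤ t := div_nonneg hpg0 hN0.le
  have htβ : t ≤ (F.scheme ℰp γ).β (K - j) ^ ε := by
    rw [hβ, ht, div_le_iff₀ hN0]
    calc pg ≤ Mc * x⁻¹ ^ ε := hpgle
      _ ≤ N * x⁻¹ ^ ε := mul_le_mul_of_nonneg_right hMcN (Real.rpow_nonneg (inv_nonneg.mpr hx0.le) _)
      _ = x⁻¹ ^ ε * N := mul_comm _ _
  -- the event in normalised form: `θ ≤ dist1 ↔ p(g) ≤ dist1 / g`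
  have hset : {U : GaugeField (F.P K) 0 (Matrix.specialUnitaryGroup (Fin 2) ℂ) | θBal F.L γ b₀ p₀ (K - j) ≤
        GaugeGroup.dist1 (GaugeField.plaqHol
          (Averaging.iter (fun i => BlockAveraging.blockAvg (P := F.P K) (j := i) ℰp) j U) p)} =
      {U | pg ≤ GaugeGroup.dist1 (GaugeField.plaqHol
          (Averaging.iter (fun i => BlockAveraging.blockAvg (P := F.P K) (j := i) ℰp) j U) p) / g} := by
    ext U
    simp only [Set.mem_setOf_eq]
    rw [θBal_eq, ← hx, ← hg, ← hpg, le_div_iff₀ hg0, mul_comm]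
  rw [hset]
  -- Markov at `t`
  have hcher := measure_ge_le_exp_mul_mgf (μ := gibbsK F ℰp γ K)
    (X := fun U => GaugeGroup.dist1 (GaugeField.plaqHol
      (Averaging.iter (fun i => BlockAveraging.blockAvg (P := F.P K) (j := i) ℰp) j U) p) / g)
    pg ht0 (integrable_exp_mul_dist1_iter F K j p (gibbsK F ℰp γ K) hg0 ht0)
  refine hcher.trans ?_
  have hM : mgf (fun U => GaugeGroup.dist1 (GaugeField.plaqHol
      (Averaging.iter (fun i => BlockAveraging.blockAvg (P := F.P K) (j := i) ℰp) j U) p) / g) (gibbsK F ℰp γ K) t ≤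
      D * (F.scheme ℰp γ).β (K - j) ^ A * Real.exp (H * t ^ 2) := by
    simpa only [mgf] using hmgf K j hj1 hjK p t ht0 htβ
  have hβA : 0 ≤ D * (F.scheme ℰp γ).β (K - j) ^ A := mul_nonneg hD (pow_nonneg (F.scheme_β_nonneg ℰp hγ.le _) _)
  -- the exponent: `H t² − t p ≤ −p²/(2N)` since `H ≤ N/2`, `t = p/N`
  have key : H * t ^ 2 + -t * pg ≤ -(1 / (2 * N) * pg ^ 2) := by
    have ht2 : 0 ≤ t ^ 2 := sq_nonneg t
    have h1 : H * t ^ 2 ≤ N / 2 * t ^ 2 := mul_le_mul_of_nonneg_right hHN ht2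
    have h2 : N / 2 * t ^ 2 + -t * pg = -(1 / (2 * N) * pg ^ 2) := by
      rw [ht]
      field_simp
      ring
    linarith
  calc Real.exp (-t * pg) * mgf (fun U => GaugeGroup.dist1 (GaugeField.plaqHol
          (Averaging.iter (fun i => BlockAveraging.blockAvg (P := F.P K) (j := i) ℰp) j U) p) / g) (gibbsK F ℰp γ K) t
      ≤ Real.exp (-t * pg) * (D * (F.scheme ℰp γ).β (K - j) ^ A * Real.exp (H * t ^ 2)) :=
        mul_le_mul_of_nonneg_left hM (Real.exp_pos _).le
    _ = D * (F.scheme ℰp γ).β (K - j) ^ A * Real.exp (H * t ^ 2 + -t * pg) := by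
        rw [Real.exp_add]
        ring
    _ ≤ D * (F.scheme ℰp γ).β (K - j) ^ A * Real.exp (-(1 / (2 * N) * pg ^ 2)) :=
        mul_le_mul_of_nonneg_left (Real.exp_le_exp.mpr key) hβA

/-! ## §3 `HistoryTailAt` per family, the glue item BY NAME, and the door into `UnitScaleTilt.HistoryTailL` -/

/-- **`HistoryTailAt` FROM A WINDOWED MOMENT BOUND** (`0 < γ ≤ 1`, `0 < b₀`, `1 ≤ p₀`, `m ≥ 1`): the per-plaquette schema of §2 fed to the tree's
bookkeeping `T3AveragedTailProfile.historyTailAt_of_perPlaquette` (`C := D`, `A`, `c := 1/(2N) > 0`). [cite: Balaban1985UV3, (71) p.273] -/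
theorem historyTailAt_of_windowMGF (F : T3Family) {γ b₀ p₀ : ℝ} (hγ : 0 < γ) (hγ1 : γ ≤ 1) (hb₀ : 0 < b₀) (hp₀ : 1 ≤ p₀)
    {m : ℕ} (hm : 0 < m) {ε : ℝ} (hε : 0 < ε)
    (h : ∃ (H D : ℝ) (A : ℕ), 0 < H ∧ 0 ≤ D ∧ ∀ (K j : ℕ), 1 ≤ j → j ≤ K → ∀ (p : Plaq (F.P K) j) (t : ℝ), 0 ≤ t →
      t ≤ (F.scheme ℰp γ).β (K - j) ^ ε →
      ∫ U, Real.exp (t * (GaugeGroup.dist1 (GaugeField.plaqHol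
          (Averaging.iter (fun i => BlockAveraging.blockAvg (P := F.P K) (j := i) ℰp) j U) p) /
            Real.sqrt (γ * ((F.L : ℝ)⁻¹) ^ (K - j)))) ∂(gibbsK F ℰp γ K) ≤
        D * (F.scheme ℰp γ).β (K - j) ^ A * Real.exp (H * t ^ 2)) :
    HistoryTailAt F γ b₀ p₀ m := by
  obtain ⟨H, D, A, hH, hD, hmgf⟩ := h
  have hN0 : 0 < max (2 * H) (b₀ * (1 + p₀ / (2 * ε)) ^ p₀) := lt_max_of_lt_left (by linarith)
  exact historyTailAt_of_perPlaquette F hγ hγ1 hb₀ hp₀ hm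
    ⟨D, A, 1 / (2 * max (2 * H) (b₀ * (1 + p₀ / (2 * ε)) ^ p₀)), hD, by positivity,
      perPlaquette_of_windowMGF F hγ hγ1 hb₀.le (by linarith) hε hH hD hmgf⟩

/-- **THE GLUE ITEM `HistoryTailOfWindow` (stmt-QuantumFields-27840) BY NAME**: `WindowMGFL →` the body of `UnitScaleTilt.HistoryTailL`.  Given `L`
take `ε, γ₁ ≤ 1` from `WindowMGFL`; given thresholds `(b₁, p₁)` the profile is `b₀ := max b₁ 1`, `p₀ := max p₁ 3` (fixed BEFORE the top fraction
`m`); `γ₁` serves every `m`; per family and coupling §2–§3. [cite: Balaban1985UV3, (7) p.257 and (71) p.273] -/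
theorem historyTailOfWindow : Summit.QuantumFields.YangMills.Theses.ModerateWindow.HistoryTailOfWindow := by
  unfold Summit.QuantumFields.YangMills.Theses.ModerateWindow.HistoryTailOfWindow
  intro hW L b₁ p₁
  obtain ⟨ε, hε, γ₁, hγ₁, hγ₁1, hfam⟩ := hW L
  refine ⟨max b₁ 1, max p₁ 3, le_max_left _ _, le_max_left _ _, lt_max_of_lt_right one_pos,
    lt_max_of_lt_right (by norm_num), fun m hm => ⟨γ₁, hγ₁, fun F γ hFL hγ hγle => ?_⟩⟩
  obtain ⟨H, D, A, hH, hD, hmgf⟩ := hfam F γ hFL hγ hγle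
  exact historyTailAt_of_windowMGF F hγ (hγle.trans hγ₁1) (lt_max_of_lt_right one_pos)
    (le_max_of_le_right (by norm_num)) hm hε ⟨H, D, A, hH, hD, hmgf⟩

/-- **THE DOOR INTO THE CRUX**: `WindowMGFL → UnitScaleTilt.HistoryTailL` (stmt-QuantumFields-27839 ⇒ stmt-QuantumFields-19936), i.e. the line
«moderate-window»'s composition with its glue stub discharged.  CONDITIONAL: `WindowMGFL` is NOT proved here. [cite: Balaban1985UV3, (71) p.273] -/
theorem historyTailL_of_windowMGFL (hW : Summit.QuantumFields.YangMills.Theses.ModerateWindow.WindowMGFL) :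
    Summit.QuantumFields.YangMills.Theses.UnitScaleTilt.HistoryTailL :=
  historyTailOfWindow hW

end Summit.QuantumFields.YangMills.Theorems.ModerateWindowHistoryTailOfWindow

end
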